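import Summits.AnomalousDissipation.AnomalousDissipation.Theorems.BaireTransferDenseLoudDesignerForcesErgodicLine
import Literature.Dynamics.Hyperbolic.SequenceShadowingPeriodic

/-!
# Line `ergodic-budget-selection-closing` (crux `BaireTransfer.DenseLoudDesignerForces`, stmt-AnomalousDissipation-1143):
# the closing lemma from a PERIODIC CHART ENCODING of returns (Stub 2 reshaped by the third lead, 2026-08-16)

Stub 2 of the line (`stub_closingLemma`: a hyperbolic invariant measure of an NS phase has the Katok closing
property `HasKatokClosing` in an enlarged NS phase) factors as

  (analytic kernel, PROVED in `Literature/Dynamics/Hyperbolic/SequenceShadowing*.lean`, Pilyugin 1999 LNM 1706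
  Thm 1.3.1 + uniqueness + periodic shadow + the `ℓ¹` bound over a period)
  ∘ (ENCODING of returning orbit segments by `n`-periodic hyperbolic sequences of maps of the phase space `H`,
     with DECODING of periodic chart trajectories into closed orbits — `HasPeriodicChartEncoding` below: this is
     what Lyapunov/Pesin charts on local transversals of the semiflow supply (Katok 1980 Main Lemma; Barreira–Pesin
     2023 §15.1; for semiflows on Hilbert spaces Lian–Young 2012), together with the Navier–Stokes regularity that
     puts all the closed orbits into ONE compact phase).

This file defines `HasPeriodicChartEncoding K φ μ` and PROVES
* `hasKatokClosing_of_encoding : HasPeriodicChartEncoding K φ μ → HasKatokClosing K φ μ` — the quantifier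
  bookkeeping of the closing lemma: given `ℓ, η`, the pseudo-orbit error `d = min(Δ/L, η/(CL))` is fed to the
  encoding, the kernel (`IsHyperbolicSequence.exists_periodic_shadow`) produces the unique `n`-periodic shadow with
  `‖v_k‖ ≤ L d ≤ Δ`, the `ℓ¹` bound (`IsHyperbolicSequence.sum_norm_periodic_shadow_le`) gives
  `∑_{k<n} ‖v_k‖ ≤ L d` UNIFORMLY IN `n` (this, not the sup bound, controls the phase drift of the closed orbit —
  the reason equal-integer-time shadowing `∀ k ≤ n` with `δ` chosen before `n` is reachable at all), and the
  decoding returns `z ∈ K`, `T` with `|T - n| ≤ C L d ≤ η`;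
* `closingLemma_of_chartEncoding` — Stub 2 in its registered form from the single remaining stub
  `stub_chartEncoding` (hyperbolic measure of an NS phase ⇒ periodic chart encoding in an enlarged NS phase).

Nothing is asserted: the encoding is a HYPOTHESIS here and a registered stub of the skeleton
(`Cruxes/DenseLoudDesignerForces/Lines/ergodic_budget_selection_closing.lean` v5).

References: S. Yu. Pilyugin, *Shadowing in Dynamical Systems*, LNM 1706 (1999) §1.3; A. Katok, Publ. IHÉS 51
(1980) (Main Lemma); L. Barreira, Ya. Pesin, *Introduction to Smooth Ergodic Theory* (2nd ed. 2023) Thm 11.10,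
§15.1; Z. Lian, L.-S. Young, JAMS 25 (2012).
-/

set_option linter.dupNamespace false

noncomputable section

open scoped BigOperators Topology ENNReal
open Filter Set Function MeasureTheory

namespace Summit.AnomalousDissipation.AnomalousDissipation.Theorems.DenseLoudDesignerForces.Ergodic

open Literature.Analysis.FunctionSpaces Literature.Analysis.FunctionSpaces.Torus
open Literature.Analysis.FluidPDE Literature.Analysis.FluidPDE.Torus
open Literature.Dynamics.Hyperbolic
open Summit.AnomalousDissipation.AnomalousDissipation.Theorems.DenseLoudDesignerForces.Negative

/-- **PERIODIC CHART ENCODING OF RETURNS (the chart side of the closing lemma for the semiflow `φ` on `K`).**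
There are measurable sets `Λ_ℓ ⊆ K` exhausting `μ`-almost all of `H` (Pesin sets) such that for every `ℓ`
there are constants `λ ∈ (0,1)`, `N ≥ 1`, `κ ≥ 0` with `κ N₁ < 1` (`N₁ = greenBound λ N`), a chart radius
`Δ > 0` and a decoding constant `C > 0`, and for every target pseudo-orbit error `d > 0` a return radius
`r > 0`, with the property: whenever `x ∈ Λ_ℓ` returns at an integer time `n ≥ 1` to `Λ_ℓ` within distance
`r` of itself, the orbit segment is ENCODED by an `n`-periodic `(λ,N)`-hyperbolic sequence `(A, P, B)` of
bounded linear maps of `H` with forward-invariant expanding unstable parts and `n`-periodic maps `ψ_k` whose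
nonlinear parts `ψ_k - A_k` are `κ`-Lipschitz on the `Δ`-ball, with pseudo-orbit error `‖ψ_k(0)‖ ≤ d` for all
`k` and `∑_{k<n} ‖ψ_k(0)‖ ≤ d`; and periodic chart trajectories DECODE into closed orbits: an `n`-periodic
trajectory `ψ_k(v_k) = v_{k+1}` in the `Δ`-ball with `∑_{k<n} ‖v_k‖ ≤ σ` yields `z ∈ K` and `T > 0` with
`|T - n| ≤ Cσ`, `φ_T z = z`, and `dist (φ_k z) (φ_k x) ≤ Cσ` for `0 ≤ k ≤ n`.  (In the intended construction:
Lyapunov charts on local transversals along the segment, rescaled to uniform size, Poincaré maps conjugated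
into `H`, periodised by identifying the charts at `x_n` and `x_0` — continuous on `Λ_ℓ` — and decoding by
transit times, whose total drift is `O(∑‖v_k‖)`.) [cite: BarreiraPesin2023, §15.1 (closing via Lyapunov charts); Thm 11.10] -/
@[folklore] def HasPeriodicChartEncoding (K : Set Hsp) (φ : ℝ → Hsp → Hsp) (μ : Measure Hsp) : Prop :=
  ∃ Λ : ℕ → Set Hsp, (∀ ℓ, MeasurableSet (Λ ℓ)) ∧ (∀ ℓ, Λ ℓ ⊆ K) ∧ μ (⋃ ℓ, Λ ℓ)ᶜ = 0 ∧
    ∀ ℓ : ℕ, ∃ (lam N κ Δ C : ℝ), 0 < lam ∧ lam < 1 ∧ 1 ≤ N ∧ 0 ≤ κ ∧ κ * greenBound lam N < 1 ∧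
      0 < Δ ∧ 0 < C ∧
      ∀ d : ℝ, 0 < d → ∃ r : ℝ, 0 < r ∧
        ∀ x ∈ Λ ℓ, ∀ n : ℕ, 0 < n → φ n x ∈ Λ ℓ → dist (φ n x) x < r →
          ∃ (A P B : ℤ → Hsp →L[ℝ] Hsp) (ψ : ℤ → Hsp → Hsp),
            IsHyperbolicSequence A P B lam N ∧
            (∀ (k : ℤ), ∀ v ∈ unstableSpace P k, A k v ∈ unstableSpace P (k + 1)) ∧
            (∀ (k : ℤ), ∀ v ∈ unstableSpace P k, ‖v‖ ≤ lam * ‖A k v‖) ∧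
            (∀ (k : ℤ) (v v' : Hsp), ‖v‖ ≤ Δ → ‖v'‖ ≤ Δ →
              ‖(ψ k v - A k v) - (ψ k v' - A k v')‖ ≤ κ * ‖v - v'‖) ∧
            (∀ k : ℤ, A (k + n) = A k) ∧ (∀ k : ℤ, ψ (k + n) = ψ k) ∧
            (∀ k : ℤ, ‖ψ k 0‖ ≤ d) ∧ (∑ k ∈ Finset.range n, ‖ψ k 0‖ ≤ d) ∧
            ∀ (v : ℤ → Hsp) (σ : ℝ), (∀ k, ‖v k‖ ≤ Δ) → (∀ k, ψ k (v k) = v (k + 1)) →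
              (∀ k : ℤ, v (k + n) = v k) → ∑ k ∈ Finset.range n, ‖v k‖ ≤ σ →
                ∃ z ∈ K, ∃ T : ℝ, 0 < T ∧ |T - n| ≤ C * σ ∧ φ T z = z ∧
                  ∀ k : ℕ, k ≤ n → dist (φ k z) (φ k x) ≤ C * σ

/-- **THE CLOSING LEMMA FROM A PERIODIC CHART ENCODING** (quantifier bookkeeping of Katok's Main Lemma over
the certified kernel): `HasPeriodicChartEncoding K φ μ → HasKatokClosing K φ μ`.  Given `ℓ` and `η > 0`
take `d = min(Δ/L, η/(CL))`, `L = shadowConst λ N κ`, and the return radius `r(d)` of the encoding as `δ`;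
a return within `δ` is encoded, the kernel gives the `n`-periodic shadow with `‖v_k‖ ≤ Ld ≤ Δ`
(`exists_periodic_shadow`) and `∑_{k<n}‖v_k‖ ≤ Ld` (`sum_norm_periodic_shadow_le`), and decoding with
`σ = Ld` gives the closed orbit with `|T - n|, dist ≤ CLd ≤ η`. [folklore] -/
theorem hasKatokClosing_of_encoding {K : Set Hsp} {φ : ℝ → Hsp → Hsp} {μ : Measure Hsp}
    (h : HasPeriodicChartEncoding K φ μ) : HasKatokClosing K φ μ := by
  obtain ⟨Λ, hΛm, hΛK, hΛμ, hΛ⟩ := h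
  refine ⟨Λ, hΛm, hΛK, hΛμ, fun ℓ η hη => ?_⟩
  obtain ⟨lam, N, κ, Δ, C, hlam0, hlam1, hN, hκ, hκN, hΔ, hC, henc⟩ := hΛ ℓ
  -- constants of the kernel
  have hGB : 0 < greenBound lam N := by
    unfold greenBound
    have : 0 < 1 - lam := sub_pos.2 hlam1
    apply div_pos _ this
    nlinarith
  have h1κ : 0 < 1 - κ * greenBound lam N := sub_pos.2 hκN
  set L : ℝ := shadowConst lam N κ with hL
  have hLpos : 0 < L := div_pos hGB h1κ
  -- the target pseudo-orbit error
  set d : ℝ := min (Δ / L) (η / (C * L)) with hd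
  have hdpos : 0 < d := lt_min (div_pos hΔ hLpos) (div_pos hη (mul_pos hC hLpos))
  have hdΔ : d ≤ Δ / L := min_le_left _ _
  have hLd : L * d ≤ Δ := by
    have := mul_le_mul_of_nonneg_left hdΔ hLpos.le
    rwa [mul_div_cancel₀ _ hLpos.ne'] at this
  have hCLd : C * (L * d) ≤ η := by
    have h1 : d ≤ η / (C * L) := min_le_right _ _
    have h2 := mul_le_mul_of_nonneg_left h1 (mul_pos hC hLpos).le
    rw [mul_div_cancel₀ _ (mul_pos hC hLpos).ne'] at h2
    linarith [mul_assoc C L d]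
  obtain ⟨r, hr, hret⟩ := henc d hdpos
  refine ⟨r, hr, fun x hx n hn hnx hdist => ?_⟩
  obtain ⟨A, P, B, ψ, hhyp, hU, hexp, hLip, hAper, hψper, hψ0, hψsum, hdec⟩ := hret x hx n hn hnx hdist
  -- the kernel: periodic shadow in the `Ld`-ball, `ℓ¹`-small over the period
  have hdΔ' : d ≤ Δ / shadowConst lam N κ := hdΔ
  obtain ⟨v, hvb, hvt, hvper⟩ :=
    hhyp.exists_periodic_shadow hU hexp hκ hdpos.le hκN hLip hψ0 hdΔ' hψper
  have hvΔ : ∀ k, ‖v k‖ ≤ Δ := fun k => (hvb k).trans hLd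
  have hsum : ∑ k ∈ Finset.range n, ‖v k‖ ≤ L * d := by
    refine (hhyp.sum_norm_periodic_shadow_le hU hexp hκ hκN hLip hψ0 hAper hψper hvΔ hvt hvper).trans ?_
    exact mul_le_mul_of_nonneg_left hψsum hLpos.le
  -- decode
  obtain ⟨z, hzK, T, hT, hTn, hfix, hsh⟩ := hdec v (L * d) hvΔ hvt hvper hsum
  exact ⟨z, hzK, T, hT, hTn.trans hCLd, hfix, fun k hk => (hsh k hk).trans hCLd⟩

/-- **STUB 2 OF THE LINE FROM THE CHART-ENCODING STUB.**  If every hyperbolic invariant measure of an NS phase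
admits a periodic chart encoding inside some enlarged NS phase of the same force (the reshaped Stub 2 =
`stub_chartEncoding` of skeleton v5: Lyapunov charts on transversals for the NS_ν cocycle + phase enlargement +
decoding), then it has the Katok closing property there — `stub_closingLemma` in its registered form. [folklore] -/
theorem closingLemma_of_chartEncoding
    (henc : ∀ {S : Finset (Fin 3 → ℤ)} {c : ↥S → (EuclideanSpace ℂ (Fin 3))} {ν : ℝ} {K : Set Hsp} {φ : ℝ → Hsp → Hsp}
      {μ : Measure Hsp}, 0 < ν → IsNSPhase ν (force S c) K φ → IsInvariantMeasure K φ μ →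
      IsHyperbolicMeasure ν (force S c) φ μ →
      ∃ (K' : Set Hsp) (φ' : ℝ → Hsp → Hsp), K ⊆ K' ∧ (∀ t : ℝ, 0 ≤ t → ∀ x ∈ K, φ' t x = φ t x) ∧
        IsNSPhase ν (force S c) K' φ' ∧ HasPeriodicChartEncoding K' φ' μ)
    {S : Finset (Fin 3 → ℤ)} {c : ↥S → (EuclideanSpace ℂ (Fin 3))} {ν : ℝ} {K : Set Hsp} {φ : ℝ → Hsp → Hsp} {μ : Measure Hsp}
    (hν : 0 < ν) (hK : IsNSPhase ν (force S c) K φ) (hμ : IsInvariantMeasure K φ μ)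
    (hH : IsHyperbolicMeasure ν (force S c) φ μ) :
    ∃ (K' : Set Hsp) (φ' : ℝ → Hsp → Hsp), K ⊆ K' ∧ (∀ t : ℝ, 0 ≤ t → ∀ x ∈ K, φ' t x = φ t x) ∧
      IsNSPhase ν (force S c) K' φ' ∧ HasKatokClosing K' φ' μ := by
  obtain ⟨K', φ', h1, h2, h3, h4⟩ := henc hν hK hμ hH
  exact ⟨K', φ', h1, h2, h3, hasKatokClosing_of_encoding h4⟩

end Summit.AnomalousDissipation.AnomalousDissipation.Theorems.DenseLoudDesignerForces.Ergodic

end
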